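import Literature.MathematicalPhysics.QuantumFieldTheory.Balaban1983to89.HaarAnalyticZeroSetNullLocal
import Mathlib.MeasureTheory.Constructions.Pi

/-!
# `Balaban1983to89.HaarAnalyticZeroSetNullLocalPiEngine` — THE LOCAL PRODUCT ENGINE: for a compact group `G`
# faithfully represented on a log-charted linear group, EVERY Haar measure `μ`, a BOX of translated exponential windows
# `Π_i k_i·V_s ⊆ G^m` whose chart box lies in an open `O ⊆ 𝔸^m`, and `F` real-analytic on `O` with ONE non-zero chart
# point: `(⊗^m μ)({g : ρ∘g ∈ O ∧ F(ρ∘g) = 0} ∩ Π_i k_i·V_s) = 0` (Fubini induction over the factors)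

statement-level skeleton of published theorems with citation tags; proofs where landed; nothing here is a claim
about the Yang–Mills mass gap

Cell `pub-ymgap` (YM-PLAN Track A), node N09 [B12] width seat `pub-ymgap-dag-n09-w3` (g4), `--supports` K1⁷
`StabilityBAtRecordR13SepCoPH` = stmt-QuantumFields-20542 as a count-neutral helper.  File 2 of this seat's OPEN-SET
(local) edition of the real-analytic zero-set nullity (file 1 `HaarAnalyticZeroSetNullLocal`: one group variable; file 3
`HaarAnalyticZeroSetNullLocalPi`: the flat-locus and preconnected theorems on `G^ι`; file 4 `…LocalGroups`: instances).
THIS FILE is the several-variables step: dag-n09-w2's FUBINI INDUCTION `HaarAnalyticZeroSetNullPi.pi_zeroSet_eq_zero_fin`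
(for `F` real-analytic on ALL of `M_N(ℂ)^ι`; cited, not restated) re-run on BOXES of translated windows.  Split
`G^{m+1} = G × G^m` (`measurePreserving_piFinSuccAbove`); the section of the box zero set at a first coordinate
`x ∈ k_0·V_s` is the box zero set of the tail section `F(ρ x, ·)` — null by induction UNLESS `F(ρ x, ·)` vanishes at the
chart point of the witness's tail; those exceptional `x` form the trace zero set, inside `k_0·V_s`, of the ONE-variable
head section at the witness's tail (real-analytic on an open set, non-zero at the witness's head) — null by file 1's
`haar_traceZeroSet_inter_translate_window_eq_zero`.  LOCATED CONSUMER (pub-ymgap NODE 00 ∕ N09): the gauge-field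
measure `dU = Π_b dU(b)` ([Balaban1985Averaging] (10) p. 19 = the tree's `Setup.fieldMeasure`) against functionals of
the bond variables that are real-analytic only on the small-field domain (dag-n09-w3 g3 `HANDOFF.md` §g3.3) — their
analyticity there is N07's ∕ (F1)'s content, NOT claimed here.

CITATION HEADER.  [BrockerTomDieck1985] Th. Bröcker, T. tom Dieck, *Representations of Compact Lie Groups*, GTM 98
(1985), Ch. IV Thm. (2.11) (proof: «every chart of the manifold G maps the set … to a set of measure zero in ℝⁿ»), Ch. I
(5.12)–(5.13) (the product group carries the product Haar measure).  [Mityagin2015] B. S. Mityagin, Math. Notes **107**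
(2020) ∕ arXiv:1512.07276, Prop. 1 (PROVED in the tree; consumed through file 1).  [Helgason2000] Ch. I §1 Thm. 1.14 (13)
p. 96 (p28's window formula, through file 1).  [Balaban1985Averaging] T. Bałaban, CMP **98** (1985) 17–51, (10) p. 19
(`dU` — the measure this rider serves; nothing else of the paper is used).

WHAT IS PROVED (theorems only; 0 definitions, 0 named facts, 0 sorry; axioms standard).  SETTING: as in file 1
(`h : IsChartRep C ρ`, `hlie`, `G` compact, `μ` ANY Haar measure on `G`, `0 < s ≤ s_C`).
* §1 plumbing — `analyticOnNhd_section_head_on` ∕ `analyticOnNhd_section_tail_on` ∕ `analyticOnNhd_reindex_on` (LOCAL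
  twins of dag-n09-w2's section lemmas: the head ∕ tail ∕ re-indexed section of a function real-analytic on an open `O`
  is real-analytic on the open section), `continuous_rho_pi`, `measurableSet_pi_traceZeroSet` (the trace zero set in
  `G^ι` is Borel), `isOpen_box` (boxes of translated windows are open).
* §2 ★★ `pi_traceZeroSet_inter_box_eq_zero_fin` (the engine over `Fin m`, statement in the title),
  ★ `pi_traceZeroSet_inter_box_eq_zero` (any finite `ι`, by `measurePreserving_piCongrLeft`).

HONEST SCOPE.  (i) dag-n09-w2's global engine is NOT restated (it is the case `O = univ`, all windows = `G`, for `Θ`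
onto).  (ii) The user-facing flat-locus ∕ preconnected theorems are file 3.  (iii) Nothing of the cited files or of
Mathlib is re-proved.  (iv) No claim about Bałaban's renormalization group; `hreg`∕`contTOn` stay displayed; N09 is NOT
discharged; nothing continuum ∕ OS ∕ mass gap ∕ Clay.
-/

noncomputable section

open NormedSpace Set Function Filter Topology MeasureTheory
open scoped ENNReal NNReal

namespace Literature.MathematicalPhysics.QuantumFieldTheory.Balaban1983to89.HaarAnalyticZeroSetNullLocalPiEngine

open HaarExponentialChart HaarExponentialChart.IsChartRep
open HaarAnalyticZeroSetNullLocal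

/-! ## §1 Plumbing: local sections, the product representation map, measurability of the box zero set -/

section Sections

variable {E : Type*} [NormedAddCommGroup E] [NormedSpace ℝ E]

/-- The HEAD section `e ↦ F(e, w)` of a function real-analytic on an open `O ⊆ E^{m+1}` is real-analytic on the (open)
section `{e : (e, w) ∈ O}`. [cite: Mityagin2015, Proposition 1] -/
theorem analyticOnNhd_section_head_on {m : ℕ} {O : Set (Fin (m + 1) → E)} {F : (Fin (m + 1) → E) → ℂ}
    (hF : AnalyticOnNhd ℝ F O) (w : Fin m → E) :
    AnalyticOnNhd ℝ (fun e : E => F (Fin.cons e w)) {e : E | (Fin.cons e w : Fin (m + 1) → E) ∈ O} := by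
  intro e he
  have h : AnalyticAt ℝ (fun e : E => (Fin.cons e w : Fin (m + 1) → E)) e := by
    refine AnalyticAt.pi (fun j => ?_)
    refine Fin.cases ?_ (fun k => ?_) j
    · simp only [Fin.cons_zero]; exact analyticAt_id
    · simp only [Fin.cons_succ]; exact analyticAt_const
  refine (hF _ ?_).comp h
  exact he

/-- The TAIL section `w ↦ F(e₀, w)` of a function real-analytic on an open `O ⊆ E^{m+1}` is real-analytic on the
section `{w : (e₀, w) ∈ O}`. [cite: Mityagin2015, Proposition 1] -/
theorem analyticOnNhd_section_tail_on {m : ℕ} {O : Set (Fin (m + 1) → E)} {F : (Fin (m + 1) → E) → ℂ}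
    (hF : AnalyticOnNhd ℝ F O) (e₀ : E) :
    AnalyticOnNhd ℝ (fun w : Fin m → E => F (Fin.cons e₀ w)) {w : Fin m → E | (Fin.cons e₀ w : Fin (m + 1) → E) ∈ O} := by
  intro w hw
  have h : AnalyticAt ℝ (fun w : Fin m → E => (Fin.cons e₀ w : Fin (m + 1) → E)) w := by
    refine AnalyticAt.pi (fun j => ?_)
    refine Fin.cases ?_ (fun k => ?_) j
    · simp only [Fin.cons_zero]; exact analyticAt_const
    · simp only [Fin.cons_succ]
      exact (ContinuousLinearMap.proj (R := ℝ) (φ := fun _ : Fin m => E) k).analyticAt w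
  refine (hF _ ?_).comp h
  exact hw

/-- Re-indexing along a bijection keeps a function real-analytic on the re-indexed open set.
[cite: Mityagin2015, Proposition 1] -/
theorem analyticOnNhd_reindex_on {ι ι' : Type*} [Fintype ι] [Fintype ι'] (e : ι' ≃ ι) {O : Set (ι → E)}
    {F : (ι → E) → ℂ} (hF : AnalyticOnNhd ℝ F O) :
    AnalyticOnNhd ℝ (fun w : ι' → E => F (fun i => w (e.symm i))) {w : ι' → E | (fun i => w (e.symm i)) ∈ O} := by
  intro w hw
  have h : AnalyticAt ℝ (fun w : ι' → E => (fun i => w (e.symm i) : ι → E)) w :=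
    AnalyticAt.pi fun i => (ContinuousLinearMap.proj (R := ℝ) (φ := fun _ : ι' => E) (e.symm i)).analyticAt w
  refine (hF _ ?_).comp h
  exact hw

omit [NormedSpace ℝ E] in
/-- `e ↦ (e, w)` (`Fin.cons`) is continuous. [folklore] -/
private theorem continuous_cons_head {m : ℕ} (w : Fin m → E) :
    Continuous (fun e : E => (Fin.cons e w : Fin (m + 1) → E)) := by
  refine continuous_pi (fun j => ?_)
  refine Fin.cases ?_ (fun k => ?_) j
  · simp only [Fin.cons_zero]; exact continuous_id
  · simp only [Fin.cons_succ]; exact continuous_const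

omit [NormedSpace ℝ E] in
/-- `w ↦ (e₀, w)` (`Fin.cons`) is continuous. [folklore] -/
private theorem continuous_cons_tail {m : ℕ} (e₀ : E) :
    Continuous (fun w : Fin m → E => (Fin.cons e₀ w : Fin (m + 1) → E)) := by
  refine continuous_pi (fun j => ?_)
  refine Fin.cases ?_ (fun k => ?_) j
  · simp only [Fin.cons_zero]; exact continuous_const
  · simp only [Fin.cons_succ]; exact continuous_apply k

end Sections

section Generic

variable {𝔸 : Type*} [NormedRing 𝔸] [NormedAlgebra ℂ 𝔸] [CompleteSpace 𝔸]
variable {G : Type*} [Group G] [TopologicalSpace G] [IsTopologicalGroup G] [CompactSpace G]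
variable {C : LogChart 𝔸} {ρ : G →* 𝔸} [FiniteDimensional ℝ C.lie]
variable [MeasurableSpace G] [BorelSpace G] (μ : Measure G) [μ.IsHaarMeasure]

omit [CompleteSpace 𝔸] [IsTopologicalGroup G] [CompactSpace G] [FiniteDimensional ℝ C.lie] [MeasurableSpace G]
  [BorelSpace G] in
/-- The product representation `g ↦ (ρ g_i)_i : G^ι → 𝔸^ι` is continuous. [cite: BrockerTomDieck1985, I (5.12)] -/
theorem continuous_rho_pi (h : IsChartRep C ρ) {ι : Type*} : Continuous (fun g : ι → G => fun i => ρ (g i)) :=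
  continuous_pi fun i => h.continuous.comp (continuous_apply i)

omit [CompleteSpace 𝔸] [IsTopologicalGroup G] [FiniteDimensional ℝ C.lie] in
/-- The trace zero set `{g : ρ∘g ∈ O ∧ F(ρ∘g) = 0} ⊆ G^ι` of a function continuous on the open `O` is Borel (open minus
relatively open). [cite: BrockerTomDieck1985, IV (2.11) (proof)] -/
theorem measurableSet_pi_traceZeroSet (h : IsChartRep C ρ) {ι : Type*} [Fintype ι] {O : Set (ι → 𝔸)}
    (hO : IsOpen O) {F : (ι → 𝔸) → ℂ} (hF : AnalyticOnNhd ℝ F O) :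
    MeasurableSet {g : ι → G | (fun i => ρ (g i)) ∈ O ∧ F (fun i => ρ (g i)) = 0} := by
  haveI := h.secondCountableTopology
  have hc := continuous_rho_pi h (ι := ι)
  have hU : IsOpen ((fun g : ι → G => fun i => ρ (g i)) ⁻¹' O) := hO.preimage hc
  have hcont : ContinuousOn (fun g : ι → G => F (fun i => ρ (g i))) ((fun g : ι → G => fun i => ρ (g i)) ⁻¹' O) :=
    hF.continuousOn.comp hc.continuousOn fun g hg => hg
  have hU' : IsOpen ((fun g : ι → G => fun i => ρ (g i)) ⁻¹' O ∩
      (fun g : ι → G => F (fun i => ρ (g i))) ⁻¹' {z : ℂ | z ≠ 0}) :=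
    hcont.isOpen_inter_preimage hU isOpen_ne
  have hset : {g : ι → G | (fun i => ρ (g i)) ∈ O ∧ F (fun i => ρ (g i)) = 0} =
      (fun g : ι → G => fun i => ρ (g i)) ⁻¹' O \ ((fun g : ι → G => fun i => ρ (g i)) ⁻¹' O ∩
        (fun g : ι → G => F (fun i => ρ (g i))) ⁻¹' {z : ℂ | z ≠ 0}) := by
    ext g
    simp only [mem_setOf_eq, Set.mem_sdiff, mem_inter_iff, mem_preimage, not_and, not_not]
    constructor
    · rintro ⟨hgO, hFg⟩
      exact ⟨hgO, fun _ => hFg⟩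
    · rintro ⟨hgO, himp⟩
      exact ⟨hgO, himp hgO⟩
  rw [hset]
  exact hU.measurableSet.diff hU'.measurableSet

omit [CompactSpace G] [FiniteDimensional ℝ C.lie] [MeasurableSpace G] [BorelSpace G] in
/-- The BOX of translated windows `Π_i k_i·V_s = {g : ∀ i, k_i⁻¹ g_i ∈ V_s}` is open (`s ≤ s_C`).
[cite: Helgason2000, Ch. I §1 Thm. 1.14 (13) p. 96] -/
theorem isOpen_box (h : IsChartRep C ρ) {ι : Type*} [Finite ι] {s : ℝ} (hs : s ≤ chartRadius C)
    (k : ι → G) : IsOpen {g : ι → G | ∀ i, (k i)⁻¹ * g i ∈ h.window s} := by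
  have : {g : ι → G | ∀ i, (k i)⁻¹ * g i ∈ h.window s} =
      ⋂ i, (fun g : ι → G => (k i)⁻¹ * g i) ⁻¹' h.window s := by
    ext g; simp only [mem_setOf_eq, mem_iInter, mem_preimage]
  rw [this]
  exact isOpen_iInter_of_finite fun i =>
    (h.isOpen_window hs).preimage (continuous_const.mul (continuous_apply i))

/-! ## §2 The local product engine: Fubini induction over boxes of translated windows -/

/-- ★★ **THE LOCAL PRODUCT ENGINE, `Fin m` form.**  For `0 < s ≤ s_C`, every `m`, every `k : Fin m → G`, every open
`O ⊆ 𝔸^m`, every `F` real-analytic on `O` such that the chart box `Π_i ρ(k_i)·e^{B(0,s)}` lies in `O` and carries ONE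
point with `F ≠ 0`: `(⊗^m μ)({g : ρ∘g ∈ O ∧ F(ρ∘g) = 0} ∩ Π_i k_i·V_s) = 0`.  FUBINI INDUCTION on `m`
(dag-n09-w2's `HaarAnalyticZeroSetNullPi.pi_zeroSet_eq_zero_fin`, run on boxes): split `G^{m+1} = G × G^m`
(`measurePreserving_piFinSuccAbove`); the section of the set at a first coordinate `x ∈ k_0·V_s` is the box zero set of
the tail section `F(ρ x, ·)` — null by induction unless `F(ρ x, ·)` vanishes at the chart point of the witness's tail;
such `x` lie in the trace zero set, inside `k_0·V_s`, of the ONE-variable head section at the witness's tail, which is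
real-analytic on an open set and non-zero at the witness's head — null by the one-variable module.
[cite: BrockerTomDieck1985, IV (2.11) (proof), I (5.12)] [cite: Mityagin2015, Proposition 1]
[cite: Helgason2000, Ch. I §1 Thm. 1.14 (13) p. 96] -/
theorem pi_traceZeroSet_inter_box_eq_zero_fin (h : IsChartRep C ρ)
    (hlie : ∀ x ∈ C.lie, ∀ y ∈ C.lie, x * y - y * x ∈ C.lie) {s : ℝ} (hs0 : 0 < s) (hs : s ≤ chartRadius C) :
    ∀ (m : ℕ) (k : Fin m → G) (O : Set (Fin m → 𝔸)), IsOpen O → ∀ (F : (Fin m → 𝔸) → ℂ), AnalyticOnNhd ℝ F O →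
      (∀ X : Fin m → C.lie, (∀ i, ‖X i‖ < s) → (fun i => ρ (k i) * exp (X i : 𝔸)) ∈ O) →
      (∃ X₀ : Fin m → C.lie, (∀ i, ‖X₀ i‖ < s) ∧ F (fun i => ρ (k i) * exp (X₀ i : 𝔸)) ≠ 0) →
      Measure.pi (fun _ : Fin m => μ)
        ({g : Fin m → G | (fun i => ρ (g i)) ∈ O ∧ F (fun i => ρ (g i)) = 0} ∩
          {g : Fin m → G | ∀ i, (k i)⁻¹ * g i ∈ h.window s}) = 0 := by
  haveI := h.secondCountableTopology
  haveI : IsFiniteMeasure μ := CompactSpace.isFiniteMeasure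
  intro m
  induction m with
  | zero =>
    intro k O _ F _ _ hne
    obtain ⟨X₀, -, hFX₀⟩ := hne
    have h0 : ({g : Fin 0 → G | (fun i => ρ (g i)) ∈ O ∧ F (fun i => ρ (g i)) = 0} ∩
        {g : Fin 0 → G | ∀ i, (k i)⁻¹ * g i ∈ h.window s}) = ∅ := by
      ext g
      simp only [mem_inter_iff, mem_setOf_eq, mem_empty_iff_false, iff_false, not_and]
      intro hg
      have : (fun i => ρ (g i)) = fun i => ρ (k i) * exp (X₀ i : 𝔸) := funext fun i => Fin.elim0 i
      rw [this] at hg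
      exact fun _ => absurd hg.2 hFX₀
    rw [h0, measure_empty]
  | succ m ih =>
    intro k O hO F hF hsub hne
    obtain ⟨X₀, hX₀, hFX₀⟩ := hne
    set S : Set (Fin (m + 1) → G) := {g | (fun i => ρ (g i)) ∈ O ∧ F (fun i => ρ (g i)) = 0} ∩
        {g | ∀ i, (k i)⁻¹ * g i ∈ h.window s} with hS
    have hSm : MeasurableSet S :=
      (measurableSet_pi_traceZeroSet h hO hF).inter (isOpen_box h hs k).measurableSet
    -- split off the first coordinate
    set φ := MeasurableEquiv.piFinSuccAbove (fun _ : Fin (m + 1) => G) 0 with hφ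
    have hmp : MeasurePreserving φ (Measure.pi fun _ : Fin (m + 1) => μ) (μ.prod (Measure.pi fun _ : Fin m => μ)) :=
      measurePreserving_piFinSuccAbove (fun _ : Fin (m + 1) => μ) 0
    have hsymm : ∀ p : G × (Fin m → G), φ.symm p = Fin.cons p.1 p.2 := by
      intro p
      rw [hφ, MeasurableEquiv.piFinSuccAbove_symm_apply, Fin.insertNthEquiv_zero]
      rfl
    have hpre : φ ⁻¹' (φ.symm ⁻¹' S) = S := by
      ext g
      simp only [mem_preimage, MeasurableEquiv.symm_apply_apply]
    rw [← hpre, hmp.measure_preimage ((hSm.preimage φ.symm.measurable).nullMeasurableSet)]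
    refine Measure.measure_prod_null_of_ae_null (hSm.preimage φ.symm.measurable) ?_
    -- the witness's tail, read in `𝔸`, and the one-variable head section there
    set w₀ : Fin m → 𝔸 := fun i => ρ (k i.succ) * exp (X₀ i.succ : 𝔸) with hw₀
    set f₁ : 𝔸 → ℂ := fun a => F (Fin.cons a w₀) with hf₁
    set O₁ : Set 𝔸 := {a | (Fin.cons a w₀ : Fin (m + 1) → 𝔸) ∈ O} with hO₁
    have hO₁o : IsOpen O₁ := hO.preimage (continuous_cons_head w₀)
    have hf₁a : AnalyticOnNhd ℝ f₁ O₁ := analyticOnNhd_section_head_on hF w₀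
    have hcons : ∀ (a : 𝔸) (X : C.lie), (Fin.cons (ρ (k 0) * exp (X : 𝔸)) w₀ : Fin (m + 1) → 𝔸) =
        fun i => ρ (k i) * exp ((Fin.cons X (fun j => X₀ j.succ) : Fin (m + 1) → C.lie) i : 𝔸) := by
      intro a X
      funext i
      refine Fin.cases ?_ (fun j => ?_) i
      · simp only [Fin.cons_zero]
      · simp only [Fin.cons_succ, hw₀]
    have hsub₁ : ∀ X : C.lie, ‖X‖ < s → ρ (k 0) * exp (X : 𝔸) ∈ O₁ := by
      intro X hX
      show (Fin.cons (ρ (k 0) * exp (X : 𝔸)) w₀ : Fin (m + 1) → 𝔸) ∈ O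
      rw [hcons (ρ (k 0)) X]
      refine hsub _ (fun i => Fin.cases ?_ (fun j => ?_) i)
      · simpa only [Fin.cons_zero] using hX
      · simpa only [Fin.cons_succ] using hX₀ j.succ
    have hne₁ : ∃ X : C.lie, ‖X‖ < s ∧ f₁ (ρ (k 0) * exp (X : 𝔸)) ≠ 0 := by
      refine ⟨X₀ 0, hX₀ 0, ?_⟩
      show F (Fin.cons (ρ (k 0) * exp (X₀ 0 : 𝔸)) w₀) ≠ 0
      have htail : (Fin.cons (X₀ 0) (fun j => X₀ j.succ) : Fin (m + 1) → C.lie) = X₀ := Fin.cons_self_tail X₀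
      rw [hcons (ρ (k 0)) (X₀ 0), htail]
      exact hFX₀
    -- the exceptional first coordinates are `μ`-null (the one-variable module)
    have hZ : μ ({x : G | ρ x ∈ O₁ ∧ f₁ (ρ x) = 0} ∩ {x : G | (k 0)⁻¹ * x ∈ h.window s}) = 0 :=
      haar_traceZeroSet_inter_translate_window_eq_zero μ h hlie hO₁o hf₁a hs0 hs (k 0) hsub₁ hne₁
    rw [Filter.EventuallyEq, ae_iff]
    refine measure_mono_null (fun x hx => ?_) hZ
    simp only [Pi.zero_apply, mem_setOf_eq] at hx
    -- outside the first translated window the section is empty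
    by_cases hxV : (k 0)⁻¹ * x ∈ h.window s
    swap
    · exfalso
      apply hx
      have hempty : Prod.mk x ⁻¹' (φ.symm ⁻¹' S) = ∅ := by
        ext r
        simp only [mem_preimage, hsymm, hS, mem_inter_iff, mem_setOf_eq, mem_empty_iff_false, iff_false, not_and]
        intro _ hbox
        exact hxV (by simpa only [Fin.cons_zero] using hbox 0)
      rw [hempty, measure_empty]
    -- inside: `ρ x = ρ(k 0)·e^{X₁}`
    have hxV' : (k 0)⁻¹ * x ∈ h.expChart '' Metric.ball 0 s := hxV
    obtain ⟨X₁, hX₁, hX₁e⟩ := hxV'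
    have hρx : ρ x = ρ (k 0) * exp (X₁ : 𝔸) := by
      have h1 : k 0 * h.expChart X₁ = x := by rw [hX₁e, mul_inv_cancel_left]
      rw [← h1, map_mul, h.rho_expChart]
    refine ⟨⟨?_, ?_⟩, hxV⟩
    · rw [hρx]; exact hsub₁ X₁ (mem_ball_zero_iff.1 hX₁)
    · -- `f₁ (ρ x) = 0`: otherwise the induction hypothesis makes the section null
      by_contra hfx
      apply hx
      set Fx : (Fin m → 𝔸) → ℂ := fun w => F (Fin.cons (ρ x) w) with hFx
      set Ox : Set (Fin m → 𝔸) := {w | (Fin.cons (ρ x) w : Fin (m + 1) → 𝔸) ∈ O} with hOx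
      have hc : ∀ r : Fin m → G, (fun i => ρ ((Fin.cons x r : Fin (m + 1) → G) i)) =
          Fin.cons (ρ x) (fun i => ρ (r i)) := by
        intro r
        funext i
        refine Fin.cases ?_ (fun j => ?_) i
        · simp only [Fin.cons_zero]
        · simp only [Fin.cons_succ]
      have hsec : Prod.mk x ⁻¹' (φ.symm ⁻¹' S) =
          {r : Fin m → G | (fun i => ρ (r i)) ∈ Ox ∧ Fx (fun i => ρ (r i)) = 0} ∩
            {r : Fin m → G | ∀ i, (k i.succ)⁻¹ * r i ∈ h.window s} := by
        ext r
        simp only [mem_preimage, hsymm, hS, mem_inter_iff, mem_setOf_eq, hc r, hOx, hFx]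
        constructor
        · rintro ⟨hOF, hbox⟩
          exact ⟨hOF, fun i => by simpa only [Fin.cons_succ] using hbox i.succ⟩
        · rintro ⟨hOF, hbox⟩
          refine ⟨hOF, fun i => Fin.cases ?_ (fun j => ?_) i⟩
          · simpa only [Fin.cons_zero] using hxV
          · simpa only [Fin.cons_succ] using hbox j
      rw [hsec]
      have hcx : ∀ X : Fin m → C.lie, (Fin.cons (ρ x) (fun i => ρ (k i.succ) * exp (X i : 𝔸)) : Fin (m + 1) → 𝔸) =
          fun i => ρ (k i) * exp ((Fin.cons X₁ X : Fin (m + 1) → C.lie) i : 𝔸) := by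
        intro X
        funext i
        refine Fin.cases ?_ (fun j => ?_) i
        · simp only [Fin.cons_zero, hρx]
        · simp only [Fin.cons_succ]
      refine ih (fun i => k i.succ) Ox (hO.preimage (continuous_cons_tail (ρ x))) Fx
        (analyticOnNhd_section_tail_on hF (ρ x)) ?_ ?_
      · intro X hX
        show (Fin.cons (ρ x) (fun i => ρ (k i.succ) * exp (X i : 𝔸)) : Fin (m + 1) → 𝔸) ∈ O
        rw [hcx X]
        refine hsub _ (fun i => Fin.cases ?_ (fun j => ?_) i)
        · simpa only [Fin.cons_zero] using mem_ball_zero_iff.1 hX₁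
        · simpa only [Fin.cons_succ] using hX j
      · refine ⟨fun i => X₀ i.succ, fun i => hX₀ i.succ, ?_⟩
        exact hfx

/-- ★ **THE LOCAL PRODUCT ENGINE, any finite index type** (re-indexing `ι ≃ Fin m` is measure preserving,
`measurePreserving_piCongrLeft`). [cite: BrockerTomDieck1985, IV (2.11) (proof), I (5.12)]
[cite: Mityagin2015, Proposition 1] [cite: Helgason2000, Ch. I §1 Thm. 1.14 (13) p. 96] -/
theorem pi_traceZeroSet_inter_box_eq_zero (h : IsChartRep C ρ)
    (hlie : ∀ x ∈ C.lie, ∀ y ∈ C.lie, x * y - y * x ∈ C.lie) {s : ℝ} (hs0 : 0 < s) (hs : s ≤ chartRadius C)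
    {ι : Type*} [Fintype ι] (k : ι → G) {O : Set (ι → 𝔸)} (hO : IsOpen O) {F : (ι → 𝔸) → ℂ}
    (hF : AnalyticOnNhd ℝ F O) (hsub : ∀ X : ι → C.lie, (∀ i, ‖X i‖ < s) → (fun i => ρ (k i) * exp (X i : 𝔸)) ∈ O)
    (hne : ∃ X₀ : ι → C.lie, (∀ i, ‖X₀ i‖ < s) ∧ F (fun i => ρ (k i) * exp (X₀ i : 𝔸)) ≠ 0) :
    Measure.pi (fun _ : ι => μ)
      ({g : ι → G | (fun i => ρ (g i)) ∈ O ∧ F (fun i => ρ (g i)) = 0} ∩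
        {g : ι → G | ∀ i, (k i)⁻¹ * g i ∈ h.window s}) = 0 := by
  classical
  haveI := h.secondCountableTopology
  haveI : IsFiniteMeasure μ := CompactSpace.isFiniteMeasure
  obtain ⟨X₀, hX₀, hFX₀⟩ := hne
  set m := Fintype.card ι
  set e : Fin m ≃ ι := (Fintype.equivFin ι).symm with he
  -- re-indexed data over `Fin m`
  set F' : (Fin m → 𝔸) → ℂ := fun w => F (fun i => w (e.symm i)) with hF'
  set O' : Set (Fin m → 𝔸) := {w | (fun i => w (e.symm i)) ∈ O} with hO'
  have hO'o : IsOpen O' := hO.preimage (continuous_pi fun i => continuous_apply (e.symm i))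
  have hF'a : AnalyticOnNhd ℝ F' O' := analyticOnNhd_reindex_on e hF
  set T : Set (Fin m → G) := {g : Fin m → G | (fun j => ρ (g j)) ∈ O' ∧ F' (fun j => ρ (g j)) = 0} ∩
      {g : Fin m → G | ∀ j, (k (e j))⁻¹ * g j ∈ h.window s} with hT
  have hTm : MeasurableSet T :=
    (measurableSet_pi_traceZeroSet h hO'o hF'a).inter (isOpen_box h hs _).measurableSet
  set ψ := MeasurableEquiv.piCongrLeft (fun _ : ι => G) e with hψ
  have hmp : MeasurePreserving ψ.symm (Measure.pi fun _ : ι => μ) (Measure.pi fun _ : Fin m => μ) :=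
    (measurePreserving_piCongrLeft (fun _ : ι => μ) e).symm
  have hψs : ∀ (g : ι → G) (j : Fin m), ψ.symm g j = g (e j) := by
    intro g j
    rw [hψ]
    show ((Equiv.piCongrLeft (fun _ : ι => G) e).symm g) j = g (e j)
    exact Equiv.piCongrLeft_symm_apply (fun _ : ι => G) e g j
  have hre : ∀ g : ι → G, (fun i => ρ (g (e (e.symm i)))) = fun i => ρ (g i) := by
    intro g; funext i; rw [Equiv.apply_symm_apply]
  have hpre : ψ.symm ⁻¹' T = {g : ι → G | (fun i => ρ (g i)) ∈ O ∧ F (fun i => ρ (g i)) = 0} ∩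
      {g : ι → G | ∀ i, (k i)⁻¹ * g i ∈ h.window s} := by
    ext g
    simp only [mem_preimage, hT, hF', hO', mem_inter_iff, mem_setOf_eq, hψs, hre g]
    constructor
    · rintro ⟨hOF, hbox⟩
      exact ⟨hOF, fun i => by simpa only [Equiv.apply_symm_apply] using hbox (e.symm i)⟩
    · rintro ⟨hOF, hbox⟩
      exact ⟨hOF, fun j => hbox (e j)⟩
  rw [← hpre, hmp.measure_preimage hTm.nullMeasurableSet]
  refine pi_traceZeroSet_inter_box_eq_zero_fin μ h hlie hs0 hs m (fun j => k (e j)) O' hO'o F' hF'a ?_ ?_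
  · intro X hX
    show (fun i => (fun j => ρ (k (e j)) * exp (X j : 𝔸)) (e.symm i)) ∈ O
    have := hsub (fun i => X (e.symm i)) (fun i => hX (e.symm i))
    simp only [Equiv.apply_symm_apply] at this ⊢
    exact this
  · refine ⟨fun j => X₀ (e j), fun j => hX₀ (e j), ?_⟩
    show F (fun i => (fun j => ρ (k (e j)) * exp (X₀ (e j) : 𝔸)) (e.symm i)) ≠ 0
    simp only [Equiv.apply_symm_apply]
    exact hFX₀

end Generic

end Literature.MathematicalPhysics.QuantumFieldTheory.Balaban1983to89.HaarAnalyticZeroSetNullLocalPiEngine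

end
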